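import Literature.Analysis.FluidPDE.PeriodicLogSliceDrift
import HarnessLib

/-!
# Lei–Ren–Zhang 2019, (3.8): the differential inequality of the logarithmic estimate, per slice

Analysis/FluidPDE proofs file (theorems only, no definitions, no named facts), on the discharge
path of the named fact `Literature.Analysis.FluidPDE.leiRenZhang2019_liouville_periodic`
(Z. Lei, X. Ren, Q. S. Zhang, arXiv:1902.11229 = Math. Ann. 383 (2022), Theorem 1.1). Proof of
Lemma 3.1 (arXiv p. 7): from (3.3)–(3.7), "we get a crucial differential inequality:
`∂ₜ∫Ψζ_R² dx + C₁Ψ̄ ≤ −½∫|∇Ψ|²ζ_R² dx + C₂`, (3.8), for `t ∈ [−R²,0]` and `C₁, C₂ > 0` independent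
of `R`". This file proves the slice inequality behind (3.8) in the tree's `H`-calculus — the
periodic twin of `LeiZhang2011.log_slice_bound`: the right-hand bracket of
`energy_identity_axis_periodic` (with `η ≡ 1`, `H = −log` near the range of `F`, the cut-off
`ζ = cylCutoff (ρ/2) ρ`) is bounded by `−½G + k₁P − (2c₂P/Z)Y`, `G = ∫_{slab}H'(F)²‖∇F‖²ζ²`,
`Y = ∫_{slab}H(F)ζ²`, `Z = ∫_{slab}ζ²`, with `k₁ = 96C_φ²(1 + C_Φ²) + (2097152/3)C_T²`.

* `log_slice_bound_periodic`.

## References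

* Z. Lei, X. Ren, Q. S. Zhang, arXiv:1902.11229, §3, proof of Lemma 3.1, (3.3)–(3.8) (arXiv p. 7).
  [LeiRenZhang2019]
* Z. Lei, Q. S. Zhang, arXiv:1011.5066, proof of Lemma 3.2 (p. 9) (tree `LeiZhang2011.log_slice_bound`).
  [LeiZhang2011]
-/

noncomputable section

open MeasureTheory Set Function Filter Metric intervalIntegral
open _root_.Topology
open scoped InnerProductSpace RealInnerProductSpace NNReal ENNReal

namespace Literature.Analysis.FluidPDE

namespace LeiRenZhang2019

open LeiZhang2011

set_option maxHeartbeats 800000 in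
/-- **The slice inequality of Lemma 3.1** (Lei–Ren–Zhang 2019, (3.3)–(3.8), arXiv p. 7). At one
time slice, for `0 < P ≤ ρ`, `ε > 0`, an axially `P`-periodic `F ∈ C²` with `ε ≤ F ≤ 3` on
`{r ≤ ρ}` and `F ≥ 1` on the axis, `H ∈ C²` with `H = −log`, `H' = −1/v`, `H'' = 1/v²` on
`[ε/2, ∞)`, a `C¹` periodic drift `b` with angular stream potential `Φ` (periodic,
`∂_zΦ = ⟪b, x_h⟫`, `|Φ| ≤ C_Φ r`), and the cut-off `ζ = cylCutoff (ρ/2) ρ`: the bracket of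
`energy_identity_axis_periodic` is bounded by `−½ G + k₁ P − (2c₂P/Z) Y`,
`G = ∫_{slab}H'(F)²‖∇F‖²ζ²`, `Y = ∫_{slab}H(F)ζ²`, `Z = ∫_{slab}ζ²`,
`k₁ = 96C_φ²(1 + C_Φ²) + (2097152/3)C_T²`. [cite: LeiRenZhang2019, §3, proof of Lemma 3.1, (3.3)–(3.8) (arXiv p. 7)] -/
theorem log_slice_bound_periodic {P ρ ε : ℝ} (hP : 0 < P) (hPρ : P ≤ ρ) (hε : 0 < ε)
    {F : EuclideanSpace ℝ (Fin 3) → ℝ} (hF : ContDiff ℝ 2 F) (hFp : IsAxiallyPeriodic P F)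
    (hFb : ∀ x, cylRadius x ≤ ρ → ε ≤ F x ∧ F x ≤ 3)
    (hFax : ∀ z : ℝ, 1 ≤ F (meridianPoint (0, z)))
    {H : ℝ → ℝ} (hH : ContDiff ℝ 2 H) (hHeq : ∀ v, ε / 2 ≤ v → H v = -Real.log v)
    (hHd1 : ∀ v, ε / 2 < v → deriv H v = -v⁻¹)
    (hHd2 : ∀ v, ε / 2 < v → deriv (deriv H) v = (v ^ 2)⁻¹)
    {b : EuclideanSpace ℝ (Fin 3) → EuclideanSpace ℝ (Fin 3)} (hb1 : ContDiff ℝ 1 b)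
    (hbp : IsAxiallyPeriodic P b)
    {Φ : EuclideanSpace ℝ (Fin 3) → ℝ} (hΦ1 : ContDiff ℝ 1 Φ) (hΦp : IsAxiallyPeriodic P Φ)
    (hΦz : ∀ x, fderiv ℝ Φ x eZ = ⟪b x, horizPart x⟫) {CΦ : ℝ} (hCΦ : 0 ≤ CΦ)
    (hΦb : ∀ x, |Φ x| ≤ CΦ * cylRadius x)
    {Cφ CT : ℝ}
    (hCφ : ∀ ρ₂ ρ₁ : ℝ, 0 ≤ ρ₂ → ρ₂ < ρ₁ → ∀ x : EuclideanSpace ℝ (Fin 3),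
      ‖gradient (cylCutoff ρ₂ ρ₁) x‖ ≤ Cφ / (ρ₁ - ρ₂))
    (hCT : ∀ t, |deriv Real.smoothTransition t| ≤ CT) :
    -(∫ x in zSlab P 0, (deriv (deriv H) (F x) * ‖gradient F x‖ ^ 2 * cylCutoff (ρ / 2) ρ x ^ 2 +
        deriv H (F x) * ⟪gradient F x, gradient (fun y => cylCutoff (ρ / 2) ρ y ^ 2) x⟫)) +
      (∫ x in zSlab P 0, H (F x) * ⟪b x, gradient (fun y => cylCutoff (ρ / 2) ρ y ^ 2) x⟫) +
      ((∫ x in zSlab P 0, 2 / cylRadius x * (H (F x) *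
          fderiv ℝ (fun y => cylCutoff (ρ / 2) ρ y ^ 2) x (eR x))) +
        2 * radialConst₂ * (cylCutoff (ρ / 2) ρ 0 ^ 2 * ∫ z in (0 : ℝ)..P, H (F (meridianPoint (0, z))))) ≤
      -(1 / 2) * (∫ x in zSlab P 0, deriv H (F x) ^ 2 * ‖gradient F x‖ ^ 2 * cylCutoff (ρ / 2) ρ x ^ 2) +
        (96 * Cφ ^ 2 * (1 + CΦ ^ 2) + 2097152 / 3 * CT ^ 2) * P -
        (2 * radialConst₂ * P) / (∫ y in zSlab P 0, cylCutoff (ρ / 2) ρ y ^ 2) *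
          ∫ x in zSlab P 0, H (F x) * cylCutoff (ρ / 2) ρ x ^ 2 := by
  have hρ : 0 < ρ := hP.trans_le hPρ
  have hρ2 : 0 ≤ ρ / 2 := by positivity
  have hρρ : ρ / 2 < ρ := half_lt_self hρ
  set φ : EuclideanSpace ℝ (Fin 3) → ℝ := cylCutoff (ρ / 2) ρ with hφdef
  have hφ : ContDiff ℝ 2 φ := contDiff_cylCutoff _ _
  have hφ1 : ContDiff ℝ 1 φ := contDiff_cylCutoff _ _
  have hφz : ∀ (x : EuclideanSpace ℝ (Fin 3)) (t : ℝ), φ (x + t • eZ) = φ x := cylCutoff_add_smul_eZ _ _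
  have hφ0 : ∀ x, ρ ≤ cylRadius x → φ x = 0 := fun x hx => cylCutoff_eq_zero hρ2 hρρ hx
  obtain ⟨a, ha, haz, -, hφg⟩ := exists_gradient_cylCutoff_eq_smul_horizPart (ρ / 2) ρ
  -- ### notation
  set G : ℝ := ∫ x in zSlab P 0, deriv H (F x) ^ 2 * ‖gradient F x‖ ^ 2 * φ x ^ 2 with hG
  set Y : ℝ := ∫ x in zSlab P 0, H (F x) * φ x ^ 2 with hY
  have hG0 : 0 ≤ G := setIntegral_nonneg (measurableSet_zSlab P 0) fun x _ => by positivity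
  -- ### the link `H''(F) = H'(F)²` where `φ ≠ 0`
  have hlink : ∀ x, deriv (deriv H) (F x) * ‖gradient F x‖ ^ 2 * φ x ^ 2 =
      deriv H (F x) ^ 2 * ‖gradient F x‖ ^ 2 * φ x ^ 2 := by
    intro x
    by_cases hx : cylRadius x ≤ ρ
    · have hv : ε / 2 < F x := (half_lt_self hε).trans_le (hFb x hx).1
      rw [hHd2 _ hv, hHd1 _ hv, neg_sq, inv_pow]
    · rw [hφ0 x (not_le.1 hx).le]; ring
  -- ### `T₁`, `T₂`, `T₃`
  have hgrad := setIntegral_norm_gradient_cylCutoff_sq_le hP hρ hCφ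
  have hT1 := abs_viscous_cutoff_term_le_periodic (hF.of_le one_le_two) hH hφ1 hφ0 (ε := 1 / 6) (by norm_num) P
  have hT2 := abs_drift_term_le_periodic hP hF hFp hb1 hbp hΦ1 hΦp hΦz hCΦ hΦb hH hφ hφz hφ0 (ha 1 |>.of_le le_rfl)
    haz hφg (ε := 1 / 6) (by norm_num)
  have hT3 := integral_axis_term_log_le_periodic hP hPρ (Ψ := fun x => H (F x))
    ((hH.of_le one_le_two).comp (hF.of_le one_le_two)) (fun x => congrArg H (hFp x)) hCT
    (δ := 1 / 6) (by norm_num)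
  have hgradΨ : ∫ x in zSlab P 0, ‖gradient (fun x => H (F x)) x‖ ^ 2 * φ x ^ 2 = G := by
    rw [hG]
    refine integral_congr_ae (ae_of_all _ fun x => ?_)
    dsimp only
    have h := gradient_comp_apply ((hH.differentiable two_ne_zero) (F x)) ((hF.differentiable two_ne_zero) x)
    rw [h, norm_smul, mul_pow, Real.norm_eq_abs, sq_abs]
  rw [hgradΨ] at hT3
  -- the viscous integral split: `∫ (H''‖∇F‖²φ² + H'⟪∇F,∇φ²⟫) = G + ∫ H'⟪∇F,∇φ²⟫`
  have hH'c : Continuous (deriv H) := hH.continuous_deriv (by norm_num)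
  have hH''c : Continuous (deriv (deriv H)) := by
    have h2 : ContDiff ℝ (1 + 1) H := by rw [one_add_one_eq_two]; exact hH
    exact h2.deriv'.continuous_deriv le_rfl
  have hgradF : Continuous (gradient F) := continuous_gradient_of_contDiff (hF.of_le one_le_two)
  have hgradφ2 : Continuous (gradient fun y => φ y ^ 2) := continuous_gradient_of_contDiff (hφ1.pow 2)
  have hgradφ2_0 : ∀ x, ρ < cylRadius x → gradient (fun y => φ y ^ 2) x = 0 := by
    intro x hx
    have hopen : IsOpen {y : EuclideanSpace ℝ (Fin 3) | ρ < cylRadius y} :=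
      isOpen_lt continuous_const continuous_cylRadius
    have hev : (fun y => φ y ^ 2) =ᶠ[𝓝 x] fun _ => 0 := by
      filter_upwards [hopen.mem_nhds hx] with y hy
      simp [hφ0 y hy.le]
    rw [gradient, hev.fderiv_eq, fderiv_const_apply, map_zero]
  have hiA : IntegrableOn (fun x => deriv (deriv H) (F x) * ‖gradient F x‖ ^ 2 * φ x ^ 2) (zSlab P 0) volume :=
    integrableOn_zSlab_of_eq_zero_of_le_cylRadius
      (((hH''c.comp hF.continuous).mul (hgradF.norm.pow 2)).mul (hφ.continuous.pow 2)) (ρ := ρ)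
      (fun x hx => by simp [hφ0 x hx]) P 0
  have hiB : IntegrableOn (fun x => deriv H (F x) * ⟪gradient F x, gradient (fun y => φ y ^ 2) x⟫)
      (zSlab P 0) volume := by
    have hc : Continuous fun x => deriv H (F x) * ⟪gradient F x, gradient (fun y => φ y ^ 2) x⟫ :=
      (hH'c.comp hF.continuous).mul (hgradF.inner hgradφ2)
    exact integrableOn_zSlab_of_eq_zero_of_le_cylRadius hc (ρ := ρ + 1)
      (fun x hx => by
        show deriv H (F x) * ⟪gradient F x, gradient (fun y => φ y ^ 2) x⟫ = 0
        rw [hgradφ2_0 x (by linarith), inner_zero_right, mul_zero]) P 0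
  have hsplit : ∫ x in zSlab P 0, (deriv (deriv H) (F x) * ‖gradient F x‖ ^ 2 * φ x ^ 2 +
      deriv H (F x) * ⟪gradient F x, gradient (fun y => φ y ^ 2) x⟫) =
      G + ∫ x in zSlab P 0, deriv H (F x) * ⟪gradient F x, gradient (fun y => φ y ^ 2) x⟫ := by
    rw [integral_add hiA hiB, hG]
    congr 1
    exact integral_congr_ae (ae_of_all _ hlink)
  -- ### the boundary term is non-positive (`F ≥ 1` on the axis, `H = −log`)
  have hBd : 2 * radialConst₂ * (φ 0 ^ 2 * ∫ z in (0 : ℝ)..P, H (F (meridianPoint (0, z)))) ≤ 0 := by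
    have hc₂ : 0 < radialConst₂ := radialConst₂_pos
    have hnp : ∫ z in (0 : ℝ)..P, H (F (meridianPoint (0, z))) ≤ 0 := by
      have h : ∀ z, H (F (meridianPoint (0, z))) ≤ 0 := fun z => by
        have h1 := hFax z
        have hv : ε / 2 ≤ F (meridianPoint (0, z)) := by
          have hax : cylRadius (meridianPoint (0, z)) ≤ ρ := by
            have : cylRadius (meridianPoint (0, z)) = 0 := by simp [cylRadius, meridianPoint_apply_zero, meridianPoint_apply_one]
            rw [this]; exact hρ.le
          exact (half_le_self hε.le).trans (hFb _ hax).1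
        rw [hHeq _ hv]
        exact neg_nonpos.2 (Real.log_nonneg h1)
      have h' : 0 ≤ ∫ z in (0 : ℝ)..P, -H (F (meridianPoint (0, z))) :=
        intervalIntegral.integral_nonneg hP.le fun z _ => neg_nonneg.2 (h z)
      rw [intervalIntegral.integral_neg] at h'
      linarith
    have h2 : φ 0 ^ 2 * ∫ z in (0 : ℝ)..P, H (F (meridianPoint (0, z))) ≤ 0 :=
      mul_nonpos_iff.2 (Or.inl ⟨sq_nonneg _, hnp⟩)
    nlinarith [h2, hc₂]
  -- ### assemble
  have hT1' := (neg_le_abs _).trans hT1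
  have hT2' := (le_abs_self _).trans hT2
  have e6 : (1 / 6 : ℝ)⁻¹ = 6 := by norm_num
  rw [e6] at hT1'
  have hgrad2 : CΦ ^ 2 / (1 / 6) * ∫ x in zSlab P 0, ‖gradient φ x‖ ^ 2 ≤ CΦ ^ 2 / (1 / 6) * (16 * Cφ ^ 2 * P) :=
    mul_le_mul_of_nonneg_left hgrad (by positivity)
  have hk3 : 1048576 * CT ^ 2 / (9 * (1 / 6)) * P = 2097152 / 3 * CT ^ 2 * P := by ring
  rw [hk3] at hT3
  rw [hsplit]
  have hC6 : CΦ ^ 2 / (1 / 6) * (16 * Cφ ^ 2 * P) = 96 * Cφ ^ 2 * CΦ ^ 2 * P := by ring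
  rw [hC6] at hgrad2
  nlinarith [hT1', hT2', hT3, hBd, hgrad, hgrad2, hG0, sq_nonneg Cφ, sq_nonneg CΦ, hP.le]

end LeiRenZhang2019

end Literature.Analysis.FluidPDE

end
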